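import Mathlib
import Literature.Barriers.ValiantsHypothesis.AlgebraicNaturalProofs
import Literature.Computability.AlgebraicComplexity.ApolarityAction
import HarnessLib

/-!
# Crux `BarrierLever.SuccinctHittingSetsForVP` (stmt-ValiantsHypothesis-14610), line `registered` —
STUB `stub_derivDimension`: DIMENSION OF THE PARTIAL DERIVATIVES AT A SUPPORT-MINIMAL MONOMIAL

**What is proved (unconditional; it does NOT close the item, it discharges the registered stub
`stub_derivDimension` = STUB A of wave 3 of the skeleton
`Cruxes/SuccinctHittingSetsForVP/Lines/birth.lean`).** Let `F` be a polynomial over `ℂ` and `x^m` a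
monomial of `F` whose support `supp m` is inclusion-minimal among the supports of the monomials of
`F`. For `T ⊆ supp m` write `m|_T` for the restriction of the exponent `m` to `T` and
`∂^{m|_T} F = x^{m|_T} ⌟ F` (`apolarAction`, the action of constant-coefficient differential
operators). Then:

* `DerivDimension.coeff_apolarAction_monomial_one` : the coefficient formula
  `coeff_w (xᵛ ⌟ F) = coeff_{w+v} F · ∏_{i ∈ supp v} (w+v)_i! / w_i!`;
* `DerivDimension.coeff_tsub_apolarAction_ne_zero` : for `v ≤ m` the monomial `x^{m-v}` occurs in
  `xᵛ ⌟ F` (it comes from `x^m` alone);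
* `DerivDimension.coeff_cross_eq_zero` : for `T₀, T ⊆ supp m` with `T₀ ⊄ T` the exponent
  `m - m|_{T₀} + m|_T` has support `supp m ∖ (T₀ ∖ T) ⊊ supp m`, hence is not a monomial of `F`
  (minimality), so `x^{m - m|_{T₀}}` does NOT occur in `∂^{m|_T} F`;
* `DerivDimension.linearIndependent_apolarAction_filter` : the `2^|supp m|` derivatives
  `∂^{m|_T} F`, `T ⊆ supp m`, are linearly independent (in a vanishing combination read off the
  coefficient of `x^{m - m|_{T₀}}` for a `T₀` of maximal size with nonzero coefficient);
* `stub_derivDimension` (registered stub) : hence every finite-dimensional space containing all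
  `xᵛ ⌟ F`, `v ≤ m`, has dimension at least `2^|supp m|`.

This is the combinatorial heart of "a low-dimensional space of partial derivatives forces a
monomial with few variables" (folklore; cf. the support / rank-concentration arguments of
Forbes–Saptharishi–Shpilka 2014), consumed by STUB B (`stub_lowPartialsHit`) of the skeleton.
Axioms: `propext`, `Classical.choice`, `Quot.sound`.
-/

-- layout Summits/ValiantsHypothesis/ValiantsHypothesis forces the duplicated namespace component
set_option linter.dupNamespace false

namespace Summit.ValiantsHypothesis.ValiantsHypothesis.Theorems.BarrierLever.SuccinctHittingSetsForVP

open Literature.Barriers.ValiantsHypothesis Literature.Computability.AlgebraicComplexity MvPolynomial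

namespace DerivDimension

variable {ι : Type*}

/-- **Coefficients of a monomial derivative**: the coefficient of `x^w` in `xᵛ ⌟ F` is
`coeff_{w+v} F · ∏_{i ∈ supp v} descFactorial (w+v)_i v_i` (Iarrobino–Kanev §1.1). [folklore] -/
theorem coeff_apolarAction_monomial_one (v w : ι →₀ ℕ) (F : MvPolynomial ι ℂ) :
    coeff w (apolarAction (monomial v (1 : ℂ)) F) =
      coeff (w + v) F * ∏ i ∈ v.support, (Nat.descFactorial ((w + v) i) (v i) : ℂ) := by
  -- adapted from `Theorems.ValuativeFlip.coeff_apolarAction_monomial_one` (catalecticant HWV file)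
  classical
  induction F using MvPolynomial.induction_on' with
  | monomial d c =>
    by_cases hle : v ≤ d
    · rw [apolarAction_monomial_monomial, coeff_monomial, coeff_monomial, one_mul]
      by_cases hd : d = w + v
      · subst hd
        rw [if_pos (add_tsub_cancel_right w v), if_pos rfl]
      · have hne : d - v ≠ w := fun h' => hd (by rw [← h', tsub_add_cancel_of_le hle])
        rw [if_neg hne, if_neg hd, zero_mul]
    · rw [apolarAction_monomial_monomial_of_not_le hle, coeff_zero, coeff_monomial]
      have hd : ¬ d = w + v := fun h' => hle (h' ▸ le_add_self)
      rw [if_neg hd, zero_mul]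
  | add p q hp hq =>
    rw [apolarAction_add_right, coeff_add, coeff_add, hp, hq, add_mul]

/-- For `v ≤ m` and `x^m` a monomial of `F`, the monomial `x^{m-v}` occurs in `xᵛ ⌟ F`: its
coefficient is `coeff_m F · ∏ descFactorial m_i v_i ≠ 0`. [folklore] -/
theorem coeff_tsub_apolarAction_ne_zero {F : MvPolynomial ι ℂ} {m v : ι →₀ ℕ}
    (hm : m ∈ F.support) (hv : v ≤ m) :
    coeff (m - v) (apolarAction (monomial v (1 : ℂ)) F) ≠ 0 := by
  rw [coeff_apolarAction_monomial_one, tsub_add_cancel_of_le hv]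
  refine mul_ne_zero (mem_support_iff.mp hm) (Finset.prod_ne_zero_iff.mpr fun i _ => ?_)
  rw [Nat.cast_ne_zero, Ne, Nat.descFactorial_eq_zero_iff_lt, not_lt]
  exact Finsupp.le_def.mp hv i

/-- A restriction `m|_T` (the exponent `m` filtered to `T`) is at most `m`. [folklore] -/
theorem filter_le (m : ι →₀ ℕ) (p : ι → Prop) [DecidablePred p] : m.filter p ≤ m :=
  Finsupp.le_def.mpr fun i => by
    rw [Finsupp.filter_apply]
    split_ifs
    exacts [le_rfl, Nat.zero_le _]

/-- **The cross exponent is not a monomial of `F`.** If `supp m` is inclusion-minimal among the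
supports of the monomials of `F` and `T₀ ⊆ supp m`, `T₀ ⊄ T`, then the exponent
`m - m|_{T₀} + m|_T` — whose support `supp m ∖ (T₀ ∖ T)` is a proper subset of `supp m` — has
coefficient zero in `F`. [folklore] -/
theorem coeff_cross_eq_zero [DecidableEq ι] {F : MvPolynomial ι ℂ} {m : ι →₀ ℕ}
    (hmin : ∀ u ∈ F.support, u.support ⊆ m.support → u.support = m.support)
    {T₀ T : Finset ι} (hT₀ : T₀ ⊆ m.support) (hnot : ¬ T₀ ⊆ T) :
    coeff ((m - m.filter (· ∈ T₀)) + m.filter (· ∈ T)) F = 0 := by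
  by_contra hc
  obtain ⟨i, hi₀, hiT⟩ := Finset.not_subset.mp hnot
  have hsub : ((m - m.filter (· ∈ T₀)) + m.filter (· ∈ T)).support ⊆ m.support := by
    intro j hj
    rw [Finsupp.mem_support_iff] at hj ⊢
    contrapose! hj
    simp [Finsupp.filter_apply, hj]
  have him : i ∈ m.support := hT₀ hi₀
  rw [← hmin _ (mem_support_iff.mpr hc) hsub, Finsupp.mem_support_iff] at him
  apply him
  simp [hi₀, hiT]

/-- **Linear independence of the restricted derivatives.** If `x^m` is a monomial of `F` with
inclusion-minimal support, the derivatives `∂^{m|_T} F = x^{m|_T} ⌟ F`, `T ⊆ supp m`, are linearly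
independent: in a vanishing combination `Σ_T g_T ∂^{m|_T} F = 0` take `T₀` of maximal size with
`g_{T₀} ≠ 0` and read off the coefficient of `x^{m - m|_{T₀}}` — it is `g_{T₀}` times a nonzero
number, every other term vanishing by `coeff_cross_eq_zero`. [folklore] -/
theorem linearIndependent_apolarAction_filter [DecidableEq ι] {F : MvPolynomial ι ℂ} {m : ι →₀ ℕ}
    (hm : m ∈ F.support)
    (hmin : ∀ u ∈ F.support, u.support ⊆ m.support → u.support = m.support) :
    LinearIndependent ℂ (fun T : ↥(m.support.powerset) =>
      apolarAction (monomial (m.filter (· ∈ T.1)) (1 : ℂ)) F) := by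
  rw [Fintype.linearIndependent_iff]
  intro g hsum
  by_contra hne
  push Not at hne
  classical
  obtain ⟨T₀, hT₀, hmax⟩ := Finset.exists_max_image (Finset.univ.filter fun T => g T ≠ 0)
    (fun T => T.1.card)
    (by obtain ⟨T, hT⟩ := hne; exact ⟨T, Finset.mem_filter.mpr ⟨Finset.mem_univ _, hT⟩⟩)
  have hg₀ : g T₀ ≠ 0 := (Finset.mem_filter.mp hT₀).2
  have hT₀m : T₀.1 ⊆ m.support := Finset.mem_powerset.mp T₀.2
  -- read off the coefficient of `x^{m - m|_{T₀}}` in the vanishing combination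
  have key := congrArg (coeff (m - m.filter (· ∈ T₀.1))) hsum
  rw [coeff_sum, coeff_zero, Finset.sum_eq_single T₀] at key
  · rw [coeff_smul, smul_eq_mul] at key
    exact mul_ne_zero hg₀ (coeff_tsub_apolarAction_ne_zero hm (filter_le m _)) key
  · intro T _ hT
    rw [coeff_smul, smul_eq_mul]
    by_cases hg : g T = 0
    · rw [hg, zero_mul]
    · have hcard : T.1.card ≤ T₀.1.card :=
        hmax T (Finset.mem_filter.mpr ⟨Finset.mem_univ _, hg⟩)
      have hnot : ¬ T₀.1 ⊆ T.1 := fun hsub =>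
        hT (Subtype.ext (Finset.eq_of_subset_of_card_le hsub hcard)).symm
      rw [coeff_apolarAction_monomial_one, coeff_cross_eq_zero hmin hT₀m hnot, zero_mul, mul_zero]
  · exact fun h => absurd (Finset.mem_univ T₀) h

end DerivDimension

open DerivDimension in
/-- **STUB A (dimension of partials vs. minimal support).** If `x^m` is a monomial of `F` whose
support is inclusion-minimal among the supports of the monomials of `F`, then every
finite-dimensional space `V` containing all the derivatives `xᵛ ⌟ F`, `v ≤ m`, has dimension at
least `2^|supp m|`: it contains the `2^|supp m|` linearly independent derivatives `∂^{m|_T} F`,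
`T ⊆ supp m` (`linearIndependent_apolarAction_filter`). [folklore] -/
theorem stub_derivDimension :
    ∀ (ι : Type) [DecidableEq ι] (F : MvPolynomial ι ℂ) (m : ι →₀ ℕ), m ∈ F.support →
      (∀ u ∈ F.support, u.support ⊆ m.support → u.support = m.support) →
      ∀ V : Submodule ℂ (MvPolynomial ι ℂ), FiniteDimensional ℂ V →
        (∀ v : ι →₀ ℕ, v ≤ m → apolarAction (monomial v (1 : ℂ)) F ∈ V) →
        2 ^ m.support.card ≤ Module.finrank ℂ V := by
  intro ι _ F m hm hmin V hV hmem
  have hli := linearIndependent_apolarAction_filter hm hmin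
  have hle : Submodule.span ℂ (Set.range fun T : ↥(m.support.powerset) =>
      apolarAction (monomial (m.filter (· ∈ T.1)) (1 : ℂ)) F) ≤ V := by
    rw [Submodule.span_le]
    rintro _ ⟨T, rfl⟩
    exact hmem _ (filter_le m _)
  have hcard : Fintype.card ↥(m.support.powerset) = 2 ^ m.support.card := by
    rw [Fintype.card_coe, Finset.card_powerset]
  rw [← hcard, ← finrank_span_eq_card hli]
  exact Submodule.finrank_mono hle

end Summit.ValiantsHypothesis.ValiantsHypothesis.Theorems.BarrierLever.SuccinctHittingSetsForVP
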